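import Summits.RiemannHypothesis.RiemannHypothesis.Theses.SignCone

/-!
# `SignCone.SignConeDuality` (crux stmt-RiemannHypothesis-16304): the multiplier engine's
# structural hypotheses are load-bearing (negative-side support, cdisprove cycle 1)

Support file of the crux disprover (seat `refuter-cdisprove-stmt-RiemannHypothesis-16304-0`);
companion of the crux workfile `Cruxes/SignConeDuality/Disproof.lean` (§B4 there). No definitions.

The crux `SignConeDuality` (`∀ a > 0`, unit-slack sign-cone inequality at cutoff `a` ⟹ some
nonnegative fake von Mangoldt weight with unit slack at cutoff `a`) is closed, in every line on the
item record (rattack refuter `Probe.cone_multipliers`; idea cards `ratio-induction-multipliers`,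
`peel-one-node`), by a finite-dimensional multiplier engine of the shape

  `S ⊆ ℝ × (ι → ℝ)` closed under `+` and positive scaling, `(∀ i, 0 ≤ x.2 i) → 0 ≤ x.1` on `S`,
  Slater point `∃ x ∈ S, ∀ i, 0 < x.2 i`  ⟹  `∃ l ≥ 0, ∀ x ∈ S, ∑ i, l i * x.2 i ≤ x.1`,

instantiated at the moment set of the Weil cone `P(a)` (first coordinate `Re W_ar(F) + Re F(0)`,
others `Re F(log n)` on the strict node window `2 ≤ n < e^{2a}`). This file proves, sorry-free and
from Mathlib alone, that NEITHER structural hypothesis of that engine can be dropped — already for a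
single constraint (`ι = Fin 1`):

* `coneMultipliers_false_without_slater` — without a Slater point the conclusion fails even for a
  convex cone containing `0` (cone `{y < 0} ∪ {y = 0, L ≥ 0}`); for the crux: the node window must
  be the STRICT one (`log n < 2a`, where one bump autocorrelation is positive at every node) and a
  boundary node `e^{2a} ∈ ℕ` has to be discharged as the identically-zero functional, never fed to
  the engine;
* `coneMultipliers_false_without_add` — without closure under `+` (keeping `0 ∈ S`, positive
  scaling, the sign implication AND a Slater point) the conclusion fails (two rays through `(0, 1)`
  and `(-1, -1)`); for the crux: the quantification of its hypothesis over FAMILIES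
  `g : Fin k → ℝ → ℂ` (sums of autocorrelations) is consumed essentially — asked only of single
  autocorrelations (`k = 1`) the hypothesis would be of multi-constraint S-lemma type and no engine
  on record applies.
-/

noncomputable section

open scoped BigOperators

namespace Summit.RiemannHypothesis.RiemannHypothesis.Theorems.SignConeDuality.Negative

/-- Sets closed under `+` and positive scaling are convex (so the counterexamples below also
refute the engine variants that ask for `Convex ℝ S`, e.g. `Probe.cone_multipliers`). [folklore] -/
theorem convex_of_add_of_smul {E : Type*} [AddCommGroup E] [Module ℝ E] {S : Set E}
    (hadd : ∀ x ∈ S, ∀ y ∈ S, x + y ∈ S) (hsmul : ∀ r : ℝ, 0 < r → ∀ x ∈ S, r • x ∈ S) :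
    Convex ℝ S := by
  intro x hx y hy p q hp hq hpq
  rcases hp.lt_or_eq with hp' | hp'
  · rcases hq.lt_or_eq with hq' | hq'
    · exact hadd _ (hsmul p hp' x hx) _ (hsmul q hq' y hy)
    · subst hq'
      simp only [add_zero] at hpq
      subst hpq
      simpa using hx
  · subst hp'
    simp only [zero_add] at hpq
    subst hpq
    simpa using hy

/-- **Slater is load-bearing.** The cone `S = {y < 0} ∪ {y = 0, L ≥ 0} ⊆ ℝ × ℝ¹` contains `0`, is
convex, closed under `+` and positive scaling, and satisfies "`y ≥ 0 ⇒ L ≥ 0`"; but no `l ≥ 0`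
has `l·y ≤ L` on `S` (test `(L, y) = (-1, -ε)`, `ε ↓ 0`). It has no Slater point. [folklore] -/
theorem coneMultipliers_false_without_slater :
    ¬ ∀ (S : Set (ℝ × (Fin 1 → ℝ))),
        (0 : ℝ × (Fin 1 → ℝ)) ∈ S → Convex ℝ S →
        (∀ x ∈ S, ∀ y ∈ S, x + y ∈ S) →
        (∀ r : ℝ, 0 < r → ∀ x ∈ S, r • x ∈ S) →
        (∀ x ∈ S, (∀ i, 0 ≤ x.2 i) → 0 ≤ x.1) →
        ∃ l : Fin 1 → ℝ, (∀ i, 0 ≤ l i) ∧ ∀ x ∈ S, ∑ i, l i * x.2 i ≤ x.1 := by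
  intro H
  let S : Set (ℝ × (Fin 1 → ℝ)) := {x | x.2 0 < 0 ∨ (x.2 0 = 0 ∧ 0 ≤ x.1)}
  have hadd : ∀ x ∈ S, ∀ y ∈ S, x + y ∈ S := by
    rintro x (hx | ⟨hx, hx'⟩) y (hy | ⟨hy, hy'⟩)
    · left; simp only [Prod.snd_add, Pi.add_apply]; linarith
    · left; simp only [Prod.snd_add, Pi.add_apply]; linarith
    · left; simp only [Prod.snd_add, Pi.add_apply]; linarith
    · right
      simp only [Prod.snd_add, Pi.add_apply, Prod.fst_add]
      exact ⟨by linarith, by linarith⟩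
  have hsmul : ∀ r : ℝ, 0 < r → ∀ x ∈ S, r • x ∈ S := by
    rintro r hr x (hx | ⟨hx, hx'⟩)
    · left
      simp only [Prod.smul_snd, Pi.smul_apply, smul_eq_mul]
      nlinarith
    · right
      simp only [Prod.smul_snd, Pi.smul_apply, smul_eq_mul, Prod.smul_fst, hx, mul_zero, true_and]
      positivity
  have h0 : (0 : ℝ × (Fin 1 → ℝ)) ∈ S := Or.inr ⟨rfl, le_rfl⟩
  have hpos : ∀ x ∈ S, (∀ i, 0 ≤ x.2 i) → 0 ≤ x.1 := by
    rintro x (hx | ⟨-, hx'⟩) hx2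
    · linarith [hx2 0]
    · exact hx'
  obtain ⟨l, hl0, hl⟩ := H S h0 (convex_of_add_of_smul hadd hsmul) hadd hsmul hpos
  -- test point `(-1, -ε)` with `ε = 1/(l 0 + 1)`
  have hε : 0 < l 0 + 1 := by linarith [hl0 0]
  have hmem : ((-1 : ℝ), fun _ : Fin 1 => -(1 / (l 0 + 1))) ∈ S := by
    left
    simp only [Left.neg_neg_iff, one_div, inv_pos]
    exact hε
  have h := hl _ hmem
  simp only [Fin.sum_univ_one] at h
  rw [mul_neg, one_div, neg_le_neg_iff] at h
  have h' : l 0 * (l 0 + 1)⁻¹ < 1 := by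
    rw [← div_eq_mul_inv, div_lt_one hε]
    linarith
  linarith

/-- **Closure under `+` (the FAMILY quantifier of `Hyp a`) is load-bearing.** The union of the two
rays through `p = (0, 1)` and `q = (-1, -1)` in `ℝ × ℝ¹` contains `0`, is closed under positive
scaling, satisfies "`y ≥ 0 ⇒ L ≥ 0`" and HAS a Slater point (`p`), yet admits no multiplier:
`p` forces `l = 0` and then `q` asks `0 ≤ -1`. (Adding `p + q = (-1, 0)` would violate
"`y ≥ 0 ⇒ L ≥ 0`": the hypothesis on sums is genuinely stronger than on generators.) [folklore] -/
theorem coneMultipliers_false_without_add :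
    ¬ ∀ (S : Set (ℝ × (Fin 1 → ℝ))),
        (0 : ℝ × (Fin 1 → ℝ)) ∈ S →
        (∀ r : ℝ, 0 < r → ∀ x ∈ S, r • x ∈ S) →
        (∀ x ∈ S, (∀ i, 0 ≤ x.2 i) → 0 ≤ x.1) →
        (∃ x ∈ S, ∀ i, 0 < x.2 i) →
        ∃ l : Fin 1 → ℝ, (∀ i, 0 ≤ l i) ∧ ∀ x ∈ S, ∑ i, l i * x.2 i ≤ x.1 := by
  intro H
  let S : Set (ℝ × (Fin 1 → ℝ)) := {x | (x.1 = 0 ∧ 0 ≤ x.2 0) ∨ (x.1 = x.2 0 ∧ x.2 0 ≤ 0)}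
  have h0 : (0 : ℝ × (Fin 1 → ℝ)) ∈ S := Or.inl ⟨rfl, le_rfl⟩
  have hsmul : ∀ r : ℝ, 0 < r → ∀ x ∈ S, r • x ∈ S := by
    rintro r hr x (⟨hx, hx'⟩ | ⟨hx, hx'⟩)
    · left
      simp only [Prod.smul_fst, smul_eq_mul, hx, mul_zero, Prod.smul_snd, Pi.smul_apply, true_and]
      positivity
    · right
      simp only [Prod.smul_fst, smul_eq_mul, hx, Prod.smul_snd, Pi.smul_apply, true_and]
      nlinarith
  have hpos : ∀ x ∈ S, (∀ i, 0 ≤ x.2 i) → 0 ≤ x.1 := by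
    rintro x (⟨hx, -⟩ | ⟨hx, hx'⟩) hx2
    · rw [hx]
    · rw [hx]; exact hx2 0
  have hsl : ∃ x ∈ S, ∀ i, 0 < x.2 i :=
    ⟨((0 : ℝ), fun _ : Fin 1 => (1 : ℝ)), Or.inl ⟨rfl, zero_le_one⟩, fun _ => one_pos⟩
  obtain ⟨l, hl0, hl⟩ := H S h0 hsmul hpos hsl
  have hp := hl ((0 : ℝ), fun _ : Fin 1 => (1 : ℝ)) (Or.inl ⟨rfl, zero_le_one⟩)
  have hq := hl ((-1 : ℝ), fun _ : Fin 1 => (-1 : ℝ)) (Or.inr ⟨rfl, by norm_num⟩)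
  simp only [Fin.sum_univ_one, mul_one] at hp
  simp only [Fin.sum_univ_one, mul_neg, mul_one] at hq
  linarith [hl0 0]

end Summit.RiemannHypothesis.RiemannHypothesis.Theorems.SignConeDuality.Negative

end
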